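import Summits.AtomisticToContinuum.BoseEinsteinCondensation.Theorems.BECThomsonPrincipleGDTransferLnssAlgebraAdjoint

/-!
# Route `BECThomsonPrinciple`, crux `GDTransfer` (stmt-AtomisticToContinuum-9482), line `dyson-dressed-witness`:
# stub `lnssAlgebra`, part 2 — `Λ_nΨ`, `Λ_n†Ψ` are variation directions (L1)

Support file of `stub_lnssAlgebra`.  The LNSS excitation operators of the line's `Defs` file,
`Λ_n = n̂₀^{-1/2} a_0† a_n` (`lnssLower = rootInv ∘ Σ_i P_i^{(n)}`) and `Λ_n† = a_n† a_0 n̂₀^{-1/2}`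
(`lnssUpper = Σ_i e_n(x_i) P_i ∘ rootInv`), map `C¹` periodic Bose-symmetric functions to `C¹` periodic
Bose-symmetric functions (`isDirection_lnssLower`, `isDirection_lnssUpper`): `C¹` by one derivative under
the integral over the bounded cell (`contDiff_one_parametric_setIntegral_of_isBounded`), periodicity slot by
slot, Bose symmetry by the relabelling covariance of `P_i`, `P_i^{(n)}`, `Q_S` (part 1) and re-indexing of
the sums over `i` and over `S ≠ ∅`.  Also: continuity of all these objects, `P₀ ∘ n̂₀^{-1/2} = Θ`
(`cellAvg_zero_rootInv`) and `P_i (conj(e_n(x_i)) g) = P_i^{(n)} g` (`cellAvg_conj_cellWave_mul`).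
All [folklore] (arXiv:1211.2778 §2; LSSY2005 App. A).
-/

noncomputable section

open MeasureTheory Filter
open scoped ENNReal NNReal ComplexConjugate

namespace Summit.AtomisticToContinuum.BoseEinsteinCondensation.Cruxes.GDTransfer.DysonDressedWitness

namespace Lnss

open Literature.MathematicalPhysics.QuantumManyBody.BoseGas
open Summit.AtomisticToContinuum.BoseEinsteinCondensation.Theorems.GaussianDominationCan.Negative
open ChordVariation (continuous_foldr_cellAvg continuous_modeProj)

variable {N m : ℕ} {L : ℝ}

/-! ## Continuity -/

/-- `P_i^{(n)} g` is continuous for continuous `g`. [folklore] -/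
theorem continuous_fourierAvg (n : Fin 3 → ℤ) (i : Fin (m + 1)) {g : Config (m + 1) → ℂ}
    (hg : Continuous g) : Continuous (fourierAvg m L n i g) := by
  have hG : Continuous fun q : Space × Config (m + 1) =>
      conj (cellWave L n q.1) * g (Function.update q.2 i q.1) :=
    ((Complex.continuous_conj.comp (continuous_cellWave L n)).comp continuous_fst).mul
      (hg.comp (continuous_snd.update i continuous_fst))
  have h := continuous_parametric_setIntegral_of_isBounded (μ := volume) (isBounded_cell L)
    (measurableSet_cell L) hG
  show Continuous fun X => ((L ^ 3)⁻¹ : ℝ) •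
    ∫ y in cell L, conj (cellWave L n y) * g (Function.update X i y)
  exact (continuous_const (y := ((L ^ 3)⁻¹ : ℝ))).smul h

/-- `n̂₀^{-1/2} g` is continuous for continuous `g`. [folklore] -/
theorem continuous_rootInv {g : Config (m + 1) → ℂ} (hg : Continuous g) :
    Continuous (rootInv m L g) := by
  unfold rootInv
  exact continuous_finsetSum _ fun S _ => continuous_const.mul (continuous_modeProj S hg)

/-- `a_0† a_n g = Σ_i P_i^{(n)} g` is continuous for continuous `g`. [folklore] -/
theorem continuous_sum_fourierAvg (n : Fin 3 → ℤ) {g : Config (m + 1) → ℂ} (hg : Continuous g) :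
    Continuous fun X => ∑ i, fourierAvg m L n i g X :=
  continuous_finsetSum _ fun i _ => continuous_fourierAvg n i hg

/-- `Λ_n g` is continuous for continuous `g`. [folklore] -/
theorem continuous_lnssLower (n : Fin 3 → ℤ) {g : Config (m + 1) → ℂ} (hg : Continuous g) :
    Continuous (lnssLower m L n g) :=
  continuous_rootInv (continuous_sum_fourierAvg n hg)

/-- `Λ_n† g` is continuous for continuous `g`. [folklore] -/
theorem continuous_lnssUpper (n : Fin 3 → ℤ) {g : Config (m + 1) → ℂ} (hg : Continuous g) :
    Continuous (lnssUpper m L n g) := by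
  unfold lnssUpper
  exact continuous_finsetSum _ fun i _ =>
    ((continuous_cellWave L n).comp (continuous_apply i)).mul
      (continuous_cellAvg i (continuous_rootInv hg))

/-! ## `C¹` regularity -/

/-- The substitution `(y, X) ↦ X[i ↦ y]` is smooth (linear). [folklore] -/
theorem contDiff_update_slot {n : WithTop ℕ∞} (i : Fin N) :
    ContDiff ℝ n fun q : Space × Config N => Function.update q.2 i q.1 := by
  -- adapted from `contDiff_update_zero` of `BECThomsonPrincipleFibreRegularity`
  rw [contDiff_pi]
  intro j
  rcases eq_or_ne j i with rfl | hj
  · simp only [Function.update_self]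
    exact contDiff_fst
  · simp only [Function.update_of_ne hj]
    exact (contDiff_apply ℝ Space j).comp contDiff_snd

/-- **`P_i` preserves `C¹`** (one derivative under the integral over the bounded cell). [folklore] -/
theorem contDiff_cellAvg (i : Fin N) {g : Config N → ℂ} (hg : ContDiff ℝ 1 g) :
    ContDiff ℝ 1 (cellAvg N L i g) := by
  have hH : ContDiff ℝ 1 fun q : Space × Config N => g (Function.update q.2 i q.1) :=
    hg.comp (contDiff_update_slot i)
  show ContDiff ℝ 1 fun X => ((L ^ 3)⁻¹ : ℝ) • ∫ y in cell L, g (Function.update X i y)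
  exact (contDiff_const (c := ((L ^ 3)⁻¹ : ℝ))).smul
    (contDiff_one_parametric_setIntegral_of_isBounded (μ := volume) (isBounded_cell L)
      (measurableSet_cell L) hH)

/-- **`P_i^{(n)}` preserves `C¹`.** [folklore] -/
theorem contDiff_fourierAvg (n : Fin 3 → ℤ) (i : Fin (m + 1)) {g : Config (m + 1) → ℂ}
    (hg : ContDiff ℝ 1 g) : ContDiff ℝ 1 (fourierAvg m L n i g) := by
  have hw : ContDiff ℝ 1 fun y : Space => conj (cellWave L n y) :=
    Complex.conjCLE.contDiff.comp ((contDiff_cellWave L n).of_le (mod_cast le_top))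
  have hH : ContDiff ℝ 1 fun q : Space × Config (m + 1) =>
      conj (cellWave L n q.1) * g (Function.update q.2 i q.1) :=
    (hw.comp contDiff_fst).mul (hg.comp (contDiff_update_slot i))
  show ContDiff ℝ 1 fun X => ((L ^ 3)⁻¹ : ℝ) •
    ∫ y in cell L, conj (cellWave L n y) * g (Function.update X i y)
  exact (contDiff_const (c := ((L ^ 3)⁻¹ : ℝ))).smul
    (contDiff_one_parametric_setIntegral_of_isBounded (μ := volume) (isBounded_cell L)
      (measurableSet_cell L) hH)

/-- The `foldr` preserves `C¹`. [folklore] -/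
theorem contDiff_foldr_cellAvg (S : Finset (Fin N)) (l : List (Fin N)) {g : Config N → ℂ}
    (hg : ContDiff ℝ 1 g) :
    ContDiff ℝ 1
      (l.foldr (fun i h => if i ∈ S then cellAvg N L i h else h - cellAvg N L i h) g) := by
  induction l with
  | nil => exact hg
  | cons a l ih =>
    rw [List.foldr_cons]
    by_cases haS : a ∈ S
    · rw [if_pos haS]; exact contDiff_cellAvg a ih
    · rw [if_neg haS]; exact ih.sub (contDiff_cellAvg a ih)

/-- **`Q_S` preserves `C¹`.** [folklore] -/
theorem contDiff_modeProj (S : Finset (Fin N)) {g : Config N → ℂ} (hg : ContDiff ℝ 1 g) :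
    ContDiff ℝ 1 (modeProj N L S g) :=
  contDiff_foldr_cellAvg S _ hg

/-- **`n̂₀^{-1/2}` preserves `C¹`.** [folklore] -/
theorem contDiff_rootInv {g : Config (m + 1) → ℂ} (hg : ContDiff ℝ 1 g) :
    ContDiff ℝ 1 (rootInv m L g) := by
  unfold rootInv
  exact ContDiff.sum fun S _ => contDiff_const.mul (contDiff_modeProj S hg)

/-- **`Λ_n` preserves `C¹`.** [folklore] -/
theorem contDiff_lnssLower (n : Fin 3 → ℤ) {g : Config (m + 1) → ℂ} (hg : ContDiff ℝ 1 g) :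
    ContDiff ℝ 1 (lnssLower m L n g) := by
  unfold lnssLower
  exact contDiff_rootInv (ContDiff.sum fun i _ => contDiff_fourierAvg n i hg)

/-- **`Λ_n†` preserves `C¹`.** [folklore] -/
theorem contDiff_lnssUpper (n : Fin 3 → ℤ) {g : Config (m + 1) → ℂ} (hg : ContDiff ℝ 1 g) :
    ContDiff ℝ 1 (lnssUpper m L n g) := by
  unfold lnssUpper
  exact ContDiff.sum fun i _ =>
    (((contDiff_cellWave L n).of_le (mod_cast le_top)).comp (contDiff_apply ℝ Space i)).mul
      (contDiff_cellAvg i (contDiff_rootInv hg))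

/-! ## Periodicity -/

/-- Updating slot `i` forgets a previous translation of slot `i`. [folklore] -/
theorem update_add_single_self (X : Config N) (i : Fin N) (v y : Space) :
    Function.update (X + Pi.single i v) i y = Function.update X i y := by
  funext j
  rcases eq_or_ne j i with rfl | hj
  · simp
  · simp [hj]

/-- Updating slot `i` commutes with translating another slot. [folklore] -/
theorem update_add_single_of_ne {i j : Fin N} (hji : j ≠ i) (X : Config N) (v y : Space) :
    Function.update (X + Pi.single j v) i y = Function.update X i y + Pi.single j v := by
  funext k
  rcases eq_or_ne k i with rfl | hk
  · simp [hji.symm]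
  · simp [hk]

/-- **`P_i` preserves periodicity.** [folklore] -/
theorem cellAvg_periodic (i : Fin N) {g : Config N → ℂ}
    (hg : ∀ (X : Config N) (j : Fin N) (k : Fin 3),
      g (X + Pi.single j (EuclideanSpace.single k L)) = g X)
    (X : Config N) (j : Fin N) (k : Fin 3) :
    cellAvg N L i g (X + Pi.single j (EuclideanSpace.single k L)) = cellAvg N L i g X := by
  unfold cellAvg
  rcases eq_or_ne j i with rfl | hji
  · simp only [update_add_single_self]
  · simp only [update_add_single_of_ne hji, hg]

/-- **`P_i^{(n)}` preserves periodicity.** [folklore] -/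
theorem fourierAvg_periodic (n : Fin 3 → ℤ) (i : Fin (m + 1)) {g : Config (m + 1) → ℂ}
    (hg : ∀ (X : Config (m + 1)) (j : Fin (m + 1)) (k : Fin 3),
      g (X + Pi.single j (EuclideanSpace.single k L)) = g X)
    (X : Config (m + 1)) (j : Fin (m + 1)) (k : Fin 3) :
    fourierAvg m L n i g (X + Pi.single j (EuclideanSpace.single k L)) = fourierAvg m L n i g X := by
  unfold fourierAvg
  rcases eq_or_ne j i with rfl | hji
  · simp only [update_add_single_self]
  · simp only [update_add_single_of_ne hji, hg]

/-- The `foldr` preserves periodicity. [folklore] -/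
theorem foldr_cellAvg_periodic (S : Finset (Fin N)) (l : List (Fin N)) {g : Config N → ℂ}
    (hg : ∀ (X : Config N) (j : Fin N) (k : Fin 3),
      g (X + Pi.single j (EuclideanSpace.single k L)) = g X)
    (X : Config N) (j : Fin N) (k : Fin 3) :
    l.foldr (fun i h => if i ∈ S then cellAvg N L i h else h - cellAvg N L i h) g
        (X + Pi.single j (EuclideanSpace.single k L)) =
      l.foldr (fun i h => if i ∈ S then cellAvg N L i h else h - cellAvg N L i h) g X := by
  induction l generalizing X j k with
  | nil => exact hg X j k
  | cons a l ih =>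
    rw [List.foldr_cons]
    by_cases haS : a ∈ S
    · simp only [if_pos haS]
      exact cellAvg_periodic a ih X j k
    · simp only [if_neg haS, Pi.sub_apply]
      rw [cellAvg_periodic a ih X j k, ih X j k]

/-- **`Q_S` preserves periodicity.** [folklore] -/
theorem modeProj_periodic (S : Finset (Fin N)) {g : Config N → ℂ}
    (hg : ∀ (X : Config N) (j : Fin N) (k : Fin 3),
      g (X + Pi.single j (EuclideanSpace.single k L)) = g X)
    (X : Config N) (j : Fin N) (k : Fin 3) :
    modeProj N L S g (X + Pi.single j (EuclideanSpace.single k L)) = modeProj N L S g X :=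
  foldr_cellAvg_periodic S _ hg X j k

/-- **`n̂₀^{-1/2}` preserves periodicity.** [folklore] -/
theorem rootInv_periodic {g : Config (m + 1) → ℂ}
    (hg : ∀ (X : Config (m + 1)) (j : Fin (m + 1)) (k : Fin 3),
      g (X + Pi.single j (EuclideanSpace.single k L)) = g X)
    (X : Config (m + 1)) (j : Fin (m + 1)) (k : Fin 3) :
    rootInv m L g (X + Pi.single j (EuclideanSpace.single k L)) = rootInv m L g X := by
  unfold rootInv
  exact Finset.sum_congr rfl fun S _ => by rw [modeProj_periodic S hg X j k]

/-- **`Λ_n` preserves periodicity.** [folklore] -/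
theorem lnssLower_periodic (n : Fin 3 → ℤ) {g : Config (m + 1) → ℂ}
    (hg : ∀ (X : Config (m + 1)) (j : Fin (m + 1)) (k : Fin 3),
      g (X + Pi.single j (EuclideanSpace.single k L)) = g X)
    (X : Config (m + 1)) (j : Fin (m + 1)) (k : Fin 3) :
    lnssLower m L n g (X + Pi.single j (EuclideanSpace.single k L)) = lnssLower m L n g X := by
  unfold lnssLower
  exact rootInv_periodic (fun Y j' k' => Finset.sum_congr rfl fun i _ =>
    fourierAvg_periodic n i hg Y j' k') X j k

/-- **`Λ_n†` preserves periodicity** (`L ≠ 0`: the plane wave `e_n` is `Lℤ³`-periodic). [folklore] -/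
theorem lnssUpper_periodic (hL : L ≠ 0) (n : Fin 3 → ℤ) {g : Config (m + 1) → ℂ}
    (hg : ∀ (X : Config (m + 1)) (j : Fin (m + 1)) (k : Fin 3),
      g (X + Pi.single j (EuclideanSpace.single k L)) = g X)
    (X : Config (m + 1)) (j : Fin (m + 1)) (k : Fin 3) :
    lnssUpper m L n g (X + Pi.single j (EuclideanSpace.single k L)) = lnssUpper m L n g X := by
  unfold lnssUpper
  refine Finset.sum_congr rfl fun i _ => ?_
  rw [cellAvg_periodic i (rootInv_periodic hg) X j k, Pi.add_apply]
  rcases eq_or_ne i j with rfl | hij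
  · rw [Pi.single_eq_same, cellWave_periodic hL]
  · rw [Pi.single_eq_of_ne hij, add_zero]

/-! ## Bose symmetry -/

/-- Relabelling intertwines the flat Fourier coefficients:
`(P_j^{(n)} g)(X ∘ τ) = (P_{τ j}^{(n)} (g ∘ (· ∘ τ)))(X)`. [folklore] -/
theorem fourierAvg_comp_perm (n : Fin 3 → ℤ) (τ : Equiv.Perm (Fin (m + 1))) (j : Fin (m + 1))
    (g : Config (m + 1) → ℂ) (X : Config (m + 1)) :
    fourierAvg m L n j g (X ∘ τ) = fourierAvg m L n (τ j) (fun Y => g (Y ∘ τ)) X := by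
  unfold fourierAvg
  simp only [Function.update_comp_equiv, Equiv.symm_apply_apply]

/-- For Bose-symmetric `g`: `(P_j^{(n)} g)(X ∘ τ) = (P_{τ j}^{(n)} g)(X)`. [folklore] -/
theorem fourierAvg_comp_perm_of_symm (n : Fin 3 → ℤ) (τ : Equiv.Perm (Fin (m + 1)))
    (j : Fin (m + 1)) {g : Config (m + 1) → ℂ}
    (hsymm : ∀ (σ : Equiv.Perm (Fin (m + 1))) (X : Config (m + 1)), g (X ∘ σ) = g X)
    (X : Config (m + 1)) :
    fourierAvg m L n j g (X ∘ τ) = fourierAvg m L n (τ j) g X := by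
  have hg : (fun Y => g (Y ∘ τ)) = g := funext fun Y => hsymm τ Y
  rw [fourierAvg_comp_perm, hg]

/-- For Bose-symmetric `g`: `(P_j g)(X ∘ τ) = (P_{τ j} g)(X)`. [folklore] -/
theorem cellAvg_comp_perm_of_symm (τ : Equiv.Perm (Fin N)) (j : Fin N) {g : Config N → ℂ}
    (hsymm : ∀ (σ : Equiv.Perm (Fin N)) (X : Config N), g (X ∘ σ) = g X) (X : Config N) :
    cellAvg N L j g (X ∘ τ) = cellAvg N L (τ j) g X := by
  have hg : (fun Y => g (Y ∘ τ)) = g := funext fun Y => hsymm τ Y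
  rw [cellAvg_comp_perm, hg]

/-- **`a_0† a_n g = Σ_i P_i^{(n)} g` is Bose-symmetric** for symmetric `g`. [folklore] -/
theorem sum_fourierAvg_comp_perm (n : Fin 3 → ℤ) {g : Config (m + 1) → ℂ}
    (hsymm : ∀ (σ : Equiv.Perm (Fin (m + 1))) (X : Config (m + 1)), g (X ∘ σ) = g X)
    (τ : Equiv.Perm (Fin (m + 1))) (X : Config (m + 1)) :
    (∑ i, fourierAvg m L n i g (X ∘ τ)) = ∑ i, fourierAvg m L n i g X := by
  simp only [fourierAvg_comp_perm_of_symm n τ _ hsymm]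
  exact Equiv.sum_comp τ (fun i => fourierAvg m L n i g X)

/-- **`n̂₀^{-1/2}` commutes with relabelling** on continuous symmetric functions (covariance of
`Q_S` and re-indexing `S ↦ τS` of the sum over `S ≠ ∅`, which preserves `|S|`). [folklore] -/
theorem rootInv_comp_perm {g : Config (m + 1) → ℂ} (hg : Continuous g)
    (hsymm : ∀ (σ : Equiv.Perm (Fin (m + 1))) (X : Config (m + 1)), g (X ∘ σ) = g X)
    (τ : Equiv.Perm (Fin (m + 1))) (X : Config (m + 1)) :
    rootInv m L g (X ∘ τ) = rootInv m L g X := by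
  have hgτ : (fun Y => g (Y ∘ τ)) = g := funext fun Y => hsymm τ Y
  have hQ : ∀ S : Finset (Fin (m + 1)),
      modeProj (m + 1) L S g (X ∘ τ) = modeProj (m + 1) L (S.map τ.toEmbedding) g X := by
    intro S
    have h := congrFun (modeProj_comp_perm (L := L) τ S hg) X
    rw [hgτ] at h
    exact h
  unfold rootInv
  simp only [hQ]
  rw [Finset.sum_filter, Finset.sum_filter, ← Equiv.sum_comp (Equiv.finsetCongr τ)
    (fun S : Finset (Fin (m + 1)) => if S.Nonempty then
      ((Real.sqrt (S.card : ℝ))⁻¹ : ℂ) * modeProj (m + 1) L S g X else 0)]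
  refine Finset.sum_congr rfl fun S _ => ?_
  simp only [Equiv.finsetCongr_apply, Finset.map_nonempty, Finset.card_map]

/-- **`Λ_n` commutes with relabelling** on continuous symmetric functions. [folklore] -/
theorem lnssLower_comp_perm (n : Fin 3 → ℤ) {g : Config (m + 1) → ℂ} (hg : Continuous g)
    (hsymm : ∀ (σ : Equiv.Perm (Fin (m + 1))) (X : Config (m + 1)), g (X ∘ σ) = g X)
    (τ : Equiv.Perm (Fin (m + 1))) (X : Config (m + 1)) :
    lnssLower m L n g (X ∘ τ) = lnssLower m L n g X := by
  unfold lnssLower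
  exact rootInv_comp_perm (continuous_sum_fourierAvg n hg)
    (fun σ Y => sum_fourierAvg_comp_perm n hsymm σ Y) τ X

/-- **`Λ_n†` commutes with relabelling** on continuous symmetric functions. [folklore] -/
theorem lnssUpper_comp_perm (n : Fin 3 → ℤ) {g : Config (m + 1) → ℂ} (hg : Continuous g)
    (hsymm : ∀ (σ : Equiv.Perm (Fin (m + 1))) (X : Config (m + 1)), g (X ∘ σ) = g X)
    (τ : Equiv.Perm (Fin (m + 1))) (X : Config (m + 1)) :
    lnssUpper m L n g (X ∘ τ) = lnssUpper m L n g X := by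
  have h : ∀ i, cellAvg (m + 1) L i (rootInv m L g) (X ∘ τ) =
      cellAvg (m + 1) L (τ i) (rootInv m L g) X :=
    fun i => cellAvg_comp_perm_of_symm τ i (fun σ Y => rootInv_comp_perm hg hsymm σ Y) X
  unfold lnssUpper
  simp only [Function.comp_apply, h]
  exact Equiv.sum_comp τ (fun j => cellWave L n (X j) * cellAvg (m + 1) L j (rootInv m L g) X)

/-! ## (L1): `Λ_nΨ`, `Λ_n†Ψ` are directions -/

/-- **(L1, lower)**: `Λ_n g` is a direction for every direction `g`. [folklore] -/
theorem isDirection_lnssLower (n : Fin 3 → ℤ) {g : Config (m + 1) → ℂ} (hg : IsDirection m L g) :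
    IsDirection m L (lnssLower m L n g) :=
  ⟨contDiff_lnssLower n hg.contDiff, lnssLower_periodic n hg.periodic,
    fun σ X => lnssLower_comp_perm n hg.contDiff.continuous hg.symm σ X⟩

/-- **(L1, upper)**: `Λ_n† g` is a direction for every direction `g` (`L ≠ 0`). [folklore] -/
theorem isDirection_lnssUpper (hL : L ≠ 0) (n : Fin 3 → ℤ) {g : Config (m + 1) → ℂ}
    (hg : IsDirection m L g) : IsDirection m L (lnssUpper m L n g) :=
  ⟨contDiff_lnssUpper n hg.contDiff, lnssUpper_periodic hL n hg.periodic,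
    fun σ X => lnssUpper_comp_perm n hg.contDiff.continuous hg.symm σ X⟩

/-! ## Two identities of the cell averages -/

/-- **`P₀ ∘ n̂₀^{-1/2} = Θ`** on continuous functions: `P₀ Q_S = [0 ∈ S] Q_S`. [folklore] -/
theorem cellAvg_zero_rootInv (hL : 0 < L) {g : Config (m + 1) → ℂ} (hg : Continuous g) :
    cellAvg (m + 1) L 0 (rootInv m L g) = theta m L g := by
  unfold rootInv
  rw [cellAvg_finset_sum _ _ (fun S _ => continuous_modeProj S hg)]
  funext X
  unfold theta
  simp only [cellAvg_modeProj hL _ 0 hg, ite_apply, Pi.zero_apply, mul_ite, mul_zero]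
  rw [← Finset.sum_filter, Finset.filter_filter]
  refine Finset.sum_congr ?_ fun S _ => rfl
  ext S
  simp only [Finset.mem_filter, Finset.mem_univ, true_and, and_iff_right_iff_imp]
  exact fun h => ⟨0, h⟩

/-- **`P_i (conj(e_n(x_i)) g) = P_i^{(n)} g`.** [folklore] -/
theorem cellAvg_conj_cellWave_mul (n : Fin 3 → ℤ) (i : Fin (m + 1)) (g : Config (m + 1) → ℂ) :
    cellAvg (m + 1) L i (fun X => conj (cellWave L n (X i)) * g X) = fourierAvg m L n i g := by
  funext X
  unfold cellAvg fourierAvg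
  simp only [Function.update_self]

/-- `P_i^{(n)} g` does not depend on slot `i`. [folklore] -/
theorem fourierAvg_update (n : Fin 3 → ℤ) (i : Fin (m + 1)) (g : Config (m + 1) → ℂ)
    (X : Config (m + 1)) (z : Space) :
    fourierAvg m L n i g (Function.update X i z) = fourierAvg m L n i g X := by
  unfold fourierAvg
  simp only [Function.update_idem]

end Lnss

/-- **Part 2 of `stub_lnssAlgebra` (registered helper statement)**: (L1, lower) — the LNSS annihilator
`Λ_n` maps directions to directions. [folklore] -/
theorem lnssAlgebra_isDirection_lnssLower :
    ∀ (m : ℕ) (L : ℝ) (n : Fin 3 → ℤ)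
      (g : Literature.MathematicalPhysics.QuantumManyBody.BoseGas.Config (m + 1) → ℂ),
      IsDirection m L g → IsDirection m L (lnssLower m L n g) :=
  fun _ _ n _ hg => Lnss.isDirection_lnssLower n hg

end Summit.AtomisticToContinuum.BoseEinsteinCondensation.Cruxes.GDTransfer.DysonDressedWitness

end
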